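/-
Origin: expansion seat `planner-pub-hodgecm-pohl-g4-0`, handover 2026-08-18 (`HOME/pub-hodgecm-pohl-g4/lean/Pohl4/ToyCupFacts.lean`, md5 22cb91c7, 201 lines);
landed by the gen-6 packager in gate run 22 as `HodgeCM/Model/Toy/CupFacts.lean` (verbatim).
-/
/-
Copyright: pub-hodgecm formalisation cell (harness21, 2026). New file (not vendored).
Origin: HOME/pub-hodgecm-pohl-g4/lean/Pohl4/ToyCupFacts.lean — session planner-pub-hodgecm-pohl-g4-0 (unit pub-hodgecm-pohl-g4),
part (b) `PohlmannSpan`, generation 4.  WIP module `Pohl4.ToyCupFacts`; intended final place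
`HodgeCM/Model/Toy/CupFacts.lean` (module `HodgeCM.Model.Toy.CupFacts`; kind L5, toy model / consistency witness —
ONE NEW ADDITIVE FILE, no landed file is touched).  Depends on the landed `HodgeCM.Model.Toy.Toy` (gate run 21) and
`HodgeCM.Proofs.Pohlmann.WeightHodge` (gate run 20: `pohlmannSpan_of_facts`).
-/
import Mathlib
import Summits.HodgeConjecture.HodgeCM.Model.Toy.Toy
import Summits.HodgeConjecture.HodgeCM.Proofs.Pohlmann.WeightHodge

/-!
# The four cup-product facts N1–N4 — and hence Pohlmann's span theorem — hold in the toy model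

`HodgeCM.Geometry.CupFacts` posits four textbook facts about the cohomology ring of the intended model
(class-M candidates, referee A round 14 item 2), from which `HodgeCM.Universe.pohlmannSpan_of_facts`
(`HodgeCM.Proofs.Pohlmann.WeightHodge`) derives `PohlmannSpan` (Gao–Ullmo, JIMJ 25 (2025) Thm 3.1 "(Pohlmann)"):

* N1 `Fact_cupExterior` — `⋀^{k+1} H¹ ≅ H^{k+1}` via iterated cup product (CM products);
* N2 `Fact_cup_hodge`   — `F^p H^i ∪ F^q H^j ⊆ F^{p+q} H^{i+j}`;
* N3 `Fact_pull_H0`     — `f^* = id` on `H⁰`;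
* N4 `Fact_hodge_F0`    — `F⁰ H^k = H^k`.

This file proves all four in the exterior CM-model `toyModelWith D` / `toyModel` of `HodgeCM.Model.Toy`
(N1, N3 for an arbitrary Hodge datum `D`; N2, N4 for the canonical eigenbasis datum `exteriorHodgeData`), with
no hypothesis at all, and concludes

* `toyModel_pohlmannSpan (M : toyModel.ModelAxioms) : toyModel.PohlmannSpan`, i.e. (with `toyModel_axioms`)
  `toyModel_pohlmannSpan_of_algDuality (h28 : toyModel.Fact_algDuality) : toyModel.PohlmannSpan`;
* the weight-space facts M29 `Fact_weightSpan` / M30 `Fact_weightHodge` hold in `toyModel` likewise.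

Consequences for the package (referee A G4, non-vacuity both ways):
(i) `ModelAxioms ∧ N1 ∧ N2 ∧ N3 ∧ N4` is satisfiable (mod the single typed input M28 of `toyModel_axioms`), so a
fold of N1–N4 into `Universe.ModelAxioms` keeps the consistency witness (`toyModel_axiomsN` below records the
conjunction); (ii) `PohlmannSpan` is TRUE in a universe in which `OpenInputs` is FALSE
(`HodgeCM.Toy.toyModel_not_openInputs'`), so the field `OpenInputs.pohlmann_span` is not what makes `OpenInputs`
unsatisfiable there, and `PohlmannSpan` is not a typing artefact: its proof `pohlmannSpan_of_facts` runs, in the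
kernel, on an honest model (the exterior algebra on `⊕ (F, Φ)` with the CM-type Hodge filtrations — which is
exactly Gao–Ullmo's description of `H^•(A′, ℚ)`, loc. cit. §3.1).

## Main statements

* `HodgeCM.Toy.exteriorPower_map_zero` — `⋀⁰ f = id`;
* `HodgeCM.Toy.coe_cupPow` — in the toy model `a₀ ∪ ⋯ ∪ a_k = ι(a₀) ⋯ ι(a_k)` in the exterior algebra;
* `HodgeCM.Toy.cupExterior` — N1 for every object; `fact_cupExterior`, `fact_pull_H0` (any `D`);
* `HodgeCM.Toy.coe_theta_cupC`, `theta_cupC` — `Θ (x ∪ y) = Θ x ∧ Θ y` in all bidegrees;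
* `fact_cup_hodge`, `fact_hodge_F0` (canonical datum); `toyModel_fact_…` (the four for `toyModel`);
* `toyModel_weightSpan`, `toyModel_weightHodge`, `toyModel_pohlmannSpan`, `toyModel_pohlmannSpan_of_algDuality`,
  `toyModel_axiomsN`.
-/

noncomputable section

open scoped TensorProduct
open exteriorPower

namespace HodgeCM.Toy

variable (D : HodgeData)

/-! ### N3 — endomorphisms act trivially on `H⁰` -/

/-- `⋀⁰ f = id` for every linear endomorphism `f` (`⋀⁰ M` is spanned by the empty product). -/
theorem exteriorPower_map_zero {R : Type*} [CommRing R] {M : Type*} [AddCommGroup M] [Module R M]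
    (f : M →ₗ[R] M) : map 0 f = LinearMap.id := by
  refine LinearMap.ext_on_range (ιMulti_span R 0 M) fun a => ?_
  rw [map_apply_ιMulti, LinearMap.id_apply]
  congr 1
  funext i
  exact i.elim0

/-- **N3 in the toy model** (any Hodge datum): `f^* = ⋀⁰ f = id` on `H⁰ = ⋀⁰ L`. -/
theorem fact_pull_H0 : (toyModelWith D).Fact_pull_H0 := fun _ f => exteriorPower_map_zero f.lin

/-! ### N4 — `F⁰ = ⊤` -/

/-- **N4 in the toy model** (canonical Hodge datum): `F⁰ (ℂ ⊗ ⋀^k L X) = ⊤`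
(`Obj.hodgeF_eq_top`: every monomial has a non-negative number of holomorphic slots). -/
theorem fact_hodge_F0 : (toyModelWith exteriorHodgeData).Fact_hodge_F0 := fun X k =>
  X.hodgeF_eq_top (k := k) (p := 0) le_rfl

/-! ### N1 — the cohomology ring is the exterior algebra on `H¹`, via the cup product -/

/-- In the toy model the iterated cup product of degree-one classes is their product in the exterior
algebra: `a₀ ∪ ⋯ ∪ a_k = ι(a₀) ⋯ ι(a_k)` (`a_i ∈ ⋀¹ L ≅ L` via `oneEquiv`). -/
theorem coe_cupPow (X : Obj) : ∀ (k : ℕ) (a : Fin (k + 1) → ↥(⋀[ℚ]^1 X.L)),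
    (((toyModelWith D).cupPow X k a : ↥(⋀[ℚ]^(k + 1) X.L)) : ExteriorAlgebra ℚ X.L)
      = ExteriorAlgebra.ιMulti ℚ (k + 1) (fun i => oneEquiv ℚ X.L (a i))
  | 0, a => by
      rw [ExteriorAlgebra.ιMulti_apply, Universe.cupPow_zero]
      simp [coe_eq_ι_oneEquiv]
  | k + 1, a => by
      rw [Universe.cupPow_succ, cup_eq, wedge_coe, coe_cupPow X k (Fin.init a),
        ExteriorAlgebra.ιMulti_apply, ExteriorAlgebra.ιMulti_apply, List.ofFn_succ' (n := k + 1),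
        List.prod_concat, coe_eq_ι_oneEquiv]
      rfl

/-- **N1 in the toy model, for every object** (any Hodge datum): `⋀^{k+1} oneEquiv : ⋀^{k+1}(⋀¹ L) → ⋀^{k+1} L`
is a linear bijection carrying `a₀ ∧ ⋯ ∧ a_k` to `a₀ ∪ ⋯ ∪ a_k`. -/
theorem cupExterior (X : Obj) (k : ℕ) : (toyModelWith D).CupExterior X k := by
  refine ⟨map (k + 1) (oneEquiv ℚ X.L).toLinearMap, ⟨?_, ?_⟩, fun a => ?_⟩
  · exact map_injective (oneEquiv ℚ X.L).symm.toLinearMap (by ext x; simp)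
  · exact map_surjective (oneEquiv ℚ X.L).surjective
  · apply Subtype.ext
    rw [map_apply_ιMulti, ιMulti_apply_coe, coe_cupPow]
    rfl

/-- **N1 in the toy model** (the `Fact`, CM products; any Hodge datum). -/
theorem fact_cupExterior : (toyModelWith D).Fact_cupExterior := fun F _ Θ k =>
  cupExterior D ((toyModelWith D).cmProd F Θ) k

/-! ### N2 — the cup product respects the Hodge filtration in all bidegrees -/

/-- `Θ` is multiplicative for the complexified cup product of the toy model in ALL bidegrees
(`BC.theta_wedge` is the equal-degree case): `Θ_{i+j}(x ∪ y) = Θ_i x · Θ_j y` in `⋀_ℂ (ℂ ⊗ L)`. -/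
theorem coe_theta_cupC (X : Obj) (i j : ℕ) (x : ℂ ⊗[ℚ] ↥(⋀[ℚ]^i X.L)) (y : ℂ ⊗[ℚ] ↥(⋀[ℚ]^j X.L)) :
    ((BC.theta ℚ ℂ X.L (i + j) ((toyModelWith D).cupC X i j x y) : ⋀[ℂ]^(i + j) X.LC) :
        ExteriorAlgebra ℂ X.LC)
      = (BC.theta ℚ ℂ X.L i x : ExteriorAlgebra ℂ X.LC) * (BC.theta ℚ ℂ X.L j y) := by
  induction x using TensorProduct.induction_on with
  | zero => simp
  | tmul a m =>
      induction y using TensorProduct.induction_on with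
      | zero => simp
      | tmul a' m' =>
          rw [Universe.cupC_tmul, cup_eq]
          simp only [BC.theta_tmul, Submodule.coe_smul, BC.thetaLin_wedge, Algebra.smul_mul_assoc,
            Algebra.mul_smul_comm, smul_smul, mul_comm a' a]
      | add y y' hy hy' => simp only [map_add, hy, hy', Submodule.coe_add, mul_add]
  | add x x' hx hx' =>
      simp only [map_add, LinearMap.add_apply, hx, hx', Submodule.coe_add, add_mul]

/-- In the toy model, `Θ (x ∪ y) = Θ x ∧ Θ y` (all bidegrees). -/
theorem theta_cupC (X : Obj) (i j : ℕ) (x : ℂ ⊗[ℚ] ↥(⋀[ℚ]^i X.L)) (y : ℂ ⊗[ℚ] ↥(⋀[ℚ]^j X.L)) :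
    X.Θ (i + j) ((toyModelWith D).cupC X i j x y) = wedge ℂ X.LC i j (X.Θ i x) (X.Θ j y) := by
  apply Subtype.ext
  rw [wedge_coe]
  exact coe_theta_cupC D X i j x y

/-- **N2 in the toy model** (canonical Hodge datum): `F^p ⋀^i ∪ F^q ⋀^j ⊆ F^{p+q} ⋀^{i+j}`
(`Obj.wedge_mem_FF`: holomorphic slot counts add under `∧`). -/
theorem fact_cup_hodge : (toyModelWith exteriorHodgeData).Fact_cup_hodge := by
  intro X i j p q x y hx hy
  change x ∈ X.hodgeF i p at hx
  change y ∈ X.hodgeF j q at hy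
  change (toyModelWith exteriorHodgeData).cupC X i j x y ∈ X.hodgeF (i + j) (p + q)
  rw [Obj.mem_hodgeF] at hx hy ⊢
  rw [theta_cupC]
  exact X.wedge_mem_FF i j p q hx hy

/-! ### The four facts for `toyModel`, and Pohlmann's span theorem in the toy model -/

/-- N1 holds in `toyModel`. -/
theorem toyModel_fact_cupExterior : toyModel.Fact_cupExterior := fact_cupExterior exteriorHodgeData

/-- N2 holds in `toyModel`. -/
theorem toyModel_fact_cup_hodge : toyModel.Fact_cup_hodge := fact_cup_hodge

/-- N3 holds in `toyModel`. -/
theorem toyModel_fact_pull_H0 : toyModel.Fact_pull_H0 := fact_pull_H0 exteriorHodgeData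

/-- N4 holds in `toyModel`. -/
theorem toyModel_fact_hodge_F0 : toyModel.Fact_hodge_F0 := fact_hodge_F0

/-- M29 `Fact_weightSpan` holds in `toyModel` (given its model axioms). -/
theorem toyModel_weightSpan (M : toyModel.ModelAxioms) : toyModel.Fact_weightSpan :=
  Universe.weightSpan_of_facts M toyModel_fact_cupExterior toyModel_fact_pull_H0

/-- M30 `Fact_weightHodge` holds in `toyModel` (given its model axioms). -/
theorem toyModel_weightHodge (M : toyModel.ModelAxioms) : toyModel.Fact_weightHodge :=
  Universe.weightHodge_of_facts M toyModel_fact_cupExterior toyModel_fact_cup_hodge toyModel_fact_pull_H0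
    toyModel_fact_hodge_F0

/-- **Pohlmann's span theorem holds in the toy model** (given its model axioms): the kernel proof
`pohlmannSpan_of_facts` specialised to the exterior CM-model, where N1–N4 are theorems. -/
theorem toyModel_pohlmannSpan (M : toyModel.ModelAxioms) : toyModel.PohlmannSpan :=
  Universe.pohlmannSpan_of_facts M toyModel_fact_cupExterior toyModel_fact_cup_hodge toyModel_fact_pull_H0
    toyModel_fact_hodge_F0

/-- `PohlmannSpan` in the toy model from the single typed input M28 of `toyModel_axioms`. -/
theorem toyModel_pohlmannSpan_of_algDuality (h28 : toyModel.Fact_algDuality) : toyModel.PohlmannSpan :=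
  toyModel_pohlmannSpan (toyModel_axioms h28)

/-- **Consistency witness for a fold of N1–N4 into the model axioms**: `ModelAxioms ∧ N1 ∧ N2 ∧ N3 ∧ N4`
holds in `toyModel` (mod M28), together with `¬ OpenInputs`. -/
theorem toyModel_axiomsN (h28 : toyModel.Fact_algDuality) :
    (toyModel.ModelAxioms ∧ toyModel.Fact_cupExterior ∧ toyModel.Fact_cup_hodge ∧ toyModel.Fact_pull_H0 ∧
      toyModel.Fact_hodge_F0) ∧ ¬ toyModel.OpenInputs :=
  ⟨⟨toyModel_axioms h28, toyModel_fact_cupExterior, toyModel_fact_cup_hodge, toyModel_fact_pull_H0,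
    toyModel_fact_hodge_F0⟩, toyModel_not_openInputs'⟩

/-- `PohlmannSpan ∧ ¬ OpenInputs` in one universe (mod M28): the open-input field `pohlmann_span` is TRUE in
`toyModel` while `OpenInputs` is FALSE there. -/
theorem toyModel_pohlmannSpan_and_not_openInputs (h28 : toyModel.Fact_algDuality) :
    toyModel.PohlmannSpan ∧ ¬ toyModel.OpenInputs :=
  ⟨toyModel_pohlmannSpan_of_algDuality h28, toyModel_not_openInputs'⟩

end HodgeCM.Toy

end
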